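import Mathlib
import HarnessLib
import Summits.RiemannHypothesis.RiemannHypothesis.Theses.IntegerScrew
import Summits.RiemannHypothesis.RiemannHypothesis.Theses.ScrewNyquistFloor
import Summits.RiemannHypothesis.RiemannHypothesis.Theorems.ScrewNyquistFloorTopBlockNeg31
import Summits.RiemannHypothesis.RiemannHypothesis.Theorems.IntegerScrewTopBlockPosFinal
import Summits.RiemannHypothesis.RiemannHypothesis.Theorems.ScrewManifestCert

/-!
# Route `IntegerScrew` — the rung leaf `Manifest.NyquistFloor` and the design fact `TopBlockD16Works`

Closers for the two RH-FREE items of route `IntegerScrew` that the thin route `ScrewNyquistFloor`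
(planner sos-theory gen17; all three binders CLOSED 2026-08-26: `TopBlockNeg31` p425557, `TopBlockWavePos31`
p428124, `Assembly` p431140) makes available:

* item `stmt-RiemannHypothesis-19311` `Theses.IntegerScrew.TopBlockD16Works`
  (= `Manifest.TopBlockPairingNeg 31 ∧ Manifest.TopBlockWavePos (21/50) 8 31`): the 110-edge integer design
  `D16` pairs negatively with every screw matrix `S_N`, `N ≥ 31` (`TopBlockNeg.topBlockPairingNeg_31`, kernel
  cell certificates + head table) and non-negatively with every wave atom of frequency `t ≤ (21/50)(N − 8)`
  (`TopBlockPos.topBlockWavePos_D16`, kernel interval branch-and-bound);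
* item `stmt-RiemannHypothesis-19312` `Theses.IntegerScrew.NyquistFloor` (= `Manifest.NyquistFloor`, the
  LADDER-RH rung leaf S-P(P3), D-0061): band-limited manifest (DD-dual) certificates cannot certify `S_M ≻ 0`
  below height `c·M` — obtained here literally through the deciding theorem `Theses.ScrewNyquistFloor.closes`
  of the thin route applied to its three landed binders.

RH-FREE: statements about Suzuki's integer screw matrices and the manifest certificate dictionary; nothing
here bears on the truth of RH.
-/

namespace Summit.RiemannHypothesis.RiemannHypothesis.Theorems.IntegerScrew.Manifest

/-- **`TopBlockD16Works`** (RH-free): the design `D16` satisfies (NEG) for all `N ≥ 31` and (POS) for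
`0 < t ≤ (21/50)(N − 8)`, `N ≥ 31` — the conjunction of the two kernel-proved cruxes of route
`ScrewNyquistFloor`. [folklore] -/
theorem topBlockD16Works_holds : TopBlockD16Works :=
  And.intro TopBlockNeg.topBlockPairingNeg_31 TopBlockPos.topBlockWavePos_D16

/-- **The rung leaf `NyquistFloor`** (RH-free obstruction law for manifest SOS certificates of the screw
matrices): `∃ c > 0, ∀ n ≥ 7, ∀ tmin > 0, ∀ T, ManifestCert n tmin T → c·(n+1) ≤ T`, via the deciding theorem
of route `ScrewNyquistFloor` applied to its three landed binders. [folklore] -/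
theorem nyquistFloor_holds : NyquistFloor :=
  Summit.RiemannHypothesis.RiemannHypothesis.Theses.ScrewNyquistFloor.closes
    TopBlockNeg.topBlockNeg31 TopBlockPos.topBlockWavePos31 screwNyquistFloorAssembly_proof

/-- CLOSER of item `stmt-RiemannHypothesis-19311` (route `IntegerScrew`, decl `TopBlockD16Works`). [folklore] -/
theorem topBlockD16Works_proof :
    Summit.RiemannHypothesis.RiemannHypothesis.Theses.IntegerScrew.TopBlockD16Works :=
  topBlockD16Works_holds

/-- CLOSER of item `stmt-RiemannHypothesis-19312` (route `IntegerScrew`, decl `NyquistFloor` = the rung leaf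
S-P(P3)). [folklore] -/
theorem nyquistFloor_proof :
    Summit.RiemannHypothesis.RiemannHypothesis.Theses.IntegerScrew.NyquistFloor :=
  nyquistFloor_holds

end Summit.RiemannHypothesis.RiemannHypothesis.Theorems.IntegerScrew.Manifest

-- build re-enqueue (comment-only append re-land by rh-explicit-sos-filer-1 g2, 2026-08-26 12:1xZ): the p433970 accept of 09:10Z lost its
-- post-accept build enqueue in the 09:12Z gate outage; every declaration above is byte-identical to p433970 (sos-eng-1 gen11).
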